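import Summits.ResolutionOfSingularities.ResolutionOfSingularities.Theorems.EquisingularLiftEquisingularLiftNatCoordPointsRung
import Summits.ResolutionOfSingularities.ResolutionOfSingularities.Theorems.EquisingularLiftEquisingularLiftNatOrdinaryPointAnyVertex
import Summits.ResolutionOfSingularities.ResolutionOfSingularities.Theorems.EquisingularLiftEquisingularLiftNatBlowupProductRegular
import Summits.ResolutionOfSingularities.ResolutionOfSingularities.Theorems.EquisingularLiftEquisingularLiftNatLinearCentreSupport
import Summits.ResolutionOfSingularities.ResolutionOfSingularities.Theorems.FrobeniusClosingPatchingRelPerfectQuotientRegularityTools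
import HarnessLib

/-!
# [OURS · L1 W4.5(b)] EL♮ FOR EVERY HYPERSURFACE WHOSE SINGULAR POINTS ARE ORDINARY MULTIPLE POINTS AT COORDINATE VERTICES, EVERY DIMENSION —
# T-MULTIORD: one blow-up of the (reduced) set of points resolves (crux `Theses.EquisingularLift.EquisingularLiftNat`, stmt-ResolutionOfSingularities-20038)

NOT a statement of any manuscript; OURS kernel theorem (cell `res-hironaka`, chain w45b; seat res-D-pv-013, own initiative, counted 0). AI-written,
weaker than expert review. No definition, no `sorry`, standard axioms.

`F ∈ K[x₀,…,x_{m+2}]` a prime form and `S` a duplicate-free list of coordinates such that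
* for `c ∈ S` the vertex chart `F(x_c := 1) = Φ_c + Ψ_c` has `Φ_c` a NONSINGULAR form of degree `μ_c ≥ 1` and `Ψ_c ∈ (y)^{μ_c+1}` (the vertex `P_c` is an
  ORDINARY `μ_c`-fold point of `H = V₊(F)`), and the affine hypersurface `F(x_c := 1)` is singular at most at the origin (Jacobian: a prime containing
  `F(x_c:=1)` and all its partials contains every `y_j`);
* for `c ∉ S` the chart ring `ChartRing F c` is regular.
Then `H ⊂ ℙ^{m+2}_K` satisfies `ELNatAt p K (m+2) H ι`: `O = 𝕎(K)`, ONE blow-up of `ℙ^{m+2}_O` along the PRODUCT of the `O`-points through the `P_c`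
(`elNatAt_of_coordPointsKill`, the multi-point rung); downstairs every blow-up of `H` along `Π_c Λ_c·𝒪_H` is regular: blow-ups along a product are
regular where the blow-ups along the factors are (`MultiCentre.isRegular_of_prod`, Stacks 080A/02OS), each factor being an ordinary point
(`OrdPointAt.isRegularLocalRing_stalk_of_isBlowup_comap`, pointwise) and `H` being regular off the marked vertices (the Jacobian criterion on the charts).
The one-point case is T-ORD `OrdPoint.elNatAt_ordinaryPoint` (p545486). First specimen (next file): Cayley's 4-nodal cubic surface, nodes at the
four vertices of `ℙ³`, in every characteristic.

* `MultiOrd.exists_X_ne_not_mem_span` — a prime form lies in at most one `(x_a)`: some `x_a ∉ (F)`, `a ≠ c`;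
* `HypersurfaceSpecimen.mem_basicOpen_chart_iff` — for `w ∈ Spec (ChartRing F c)`: `ι(chart w) ∈ D₊(x_a) ↔ x_a/x_c ∉ w` (Mathlib
  `Proj.awayι_preimage_basicOpen`); `HypersurfaceSpecimen.isRegularLocalRing_stalk_chart` — `𝒪_{H, chart w} ≅ (ChartRing F c)_w`;
* `MultiOrd.isRegularLocalRing_localization_chartRing` — the Jacobian hypothesis on `F(x_c:=1)` makes `(ChartRing F c)_𝔮` regular at every prime
  `𝔮` missing some `x_a/x_c`;
* `MultiOrd.isRegularLocalRing_stalk_of_forall_exists` — hence `H` is regular at every point that is none of the marked vertices;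
* **`MultiOrd.elNatAt_ordinaryPoints`** — the theorem.

References: Hartshorne I Thm. 5.1, II Prop. 5.9; The Stacks Project 080A, 0804, 0BIQ; Matsumura Thm. 14.2 — through the cited tree files.
-/

set_option linter.dupNamespace false -- mandated namespace `Summit.<Summit>.<Problem>` of this single-conjunct summit

noncomputable section

open CategoryTheory CategoryTheory.Limits AlgebraicGeometry TopologicalSpace
open MvPolynomial HomogeneousLocalization
open Literature.AlgebraicGeometry.Resolution
open Literature.AlgebraicGeometry.Motives Literature.AlgebraicGeometry.Motives.SmoothHypersurface
open Literature.AlgebraicGeometry.Motives.ProjectiveSpace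
open AlgebraicGeometry.Scheme.IdealSheafData
open Summit.ResolutionOfSingularities.ResolutionOfSingularities.Cruxes.EquisingularLift.StrataSplit

namespace Summit.ResolutionOfSingularities.ResolutionOfSingularities.Cruxes.EquisingularLiftNat.Sections

namespace HypersurfaceSpecimen

variable (k : Type) [Field k] {n : ℕ} (F : MvPolynomial (Fin (n + 2)) k) {d : ℕ} (hF : F.IsHomogeneous d) (hd : 0 < d)

attribute [local instance] MvPolynomial.gradedAlgebra ProjBaseChange.algebraBase

/-- **On the chart `Spec (ChartRing F c)`, `D₊(x_a)` is the basic open of `x_a/x_c`** (any `n`): for `w ∈ Spec (ChartRing F c)`, `ι(chart w) ∈ D₊(x_a)` iff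
`x_a/x_c ∉ w` (`chart ≫ ι = Spec(k[x]_{(x_c)} → ChartRing F c) ≫ (D₊(x_c) ↪ ℙ)`, `chart_left_comp_ι`; Mathlib `Proj.awayι_preimage_basicOpen`). [folklore] -/
theorem mem_basicOpen_chart_iff (c a : Fin (n + 2)) (w : Spec (CommRingCat.of (ChartRing F c hF))) :
    (hypersurfaceι F).left ((chart F c hF hd).left w) ∈ Proj.basicOpen (homogeneousSubmodule (Fin (n + 2)) k) (X a) ↔
      tautVec F c hF a ∉ w.asIdeal := by
  have hcomp : (hypersurfaceι F).left ((chart F c hF hd).left w) =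
      Proj.awayι (homogeneousSubmodule (Fin (n + 2)) k) (X c) (X_mem c) one_pos
        (Spec.map (CommRingCat.ofHom (toChartRing F c hF).toRingHom) w) :=
    congrArg (fun f => f.base w) (chart_left_comp_ι k F hF hd c)
  rw [hcomp]
  change Spec.map (CommRingCat.ofHom (toChartRing F c hF).toRingHom) w ∈
      Proj.awayι (homogeneousSubmodule (Fin (n + 2)) k) (X c) (X_mem c) one_pos ⁻¹ᵁ
        Proj.basicOpen (homogeneousSubmodule (Fin (n + 2)) k) (X a) ↔ _
  rw [Proj.awayι_preimage_basicOpen (homogeneousSubmodule (Fin (n + 2)) k) (f_deg := X_mem (R := k) c) (hm := one_pos)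
      (g_deg := X_mem (R := k) a) (hm' := one_pos)]
  have hmemb : ∀ y : PrimeSpectrum (Away (homogeneousSubmodule (Fin (n + 2)) k) (X c : MvPolynomial (Fin (n + 2)) k)),
      y ∈ PrimeSpectrum.basicOpen (Away.isLocalizationElem (X_mem (R := k) c) (X_mem (R := k) a)) ↔
        Away.isLocalizationElem (X_mem (R := k) c) (X_mem (R := k) a) ∉ y.asIdeal := fun y => PrimeSpectrum.mem_basicOpen _ y
  refine (hmemb _).trans ?_
  change ¬ (Away.isLocalizationElem (X_mem (R := k) c) (X_mem (R := k) a) ∈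
    Ideal.comap (toChartRing F c hF).toRingHom w.asIdeal) ↔ _
  rw [Ideal.mem_comap]
  have heq : (toChartRing F c hF).toRingHom (Away.isLocalizationElem (X_mem (R := k) c) (X_mem (R := k) a)) = tautVec F c hF a := by
    rw [tautVec_apply]
    change toChartRing F c hF _ = toChartRing F c hF _
    congr 1
    refine HomogeneousLocalization.val_injective _ ?_
    rw [coord, Away.val_mk, Away.val_mk, pow_one]
  rw [heq]

/-- **Under the chart the stalk is the localisation of the chart ring** (any `n`): `𝒪_{H, chart w} ≅ (ChartRing F c)_w`, so the former is regular if the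
latter is. [cite: StacksProject, Tag 01I1] -/
theorem isRegularLocalRing_stalk_chart (c : Fin (n + 2)) (w : Spec (CommRingCat.of (ChartRing F c hF)))
    (hw : IsRegularLocalRing (Localization.AtPrime w.asIdeal)) :
    IsRegularLocalRing ((hypersurface F).left.presheaf.stalk ((chart F c hF hd).left w)) := by
  by_contra h
  exact @not_isRegularLocalRing_localization_of_stalk (CommRingCat.of (ChartRing F c hF)) (hypersurface F).left (chart F c hF hd).left
    (isOpenImmersion_chart_left F c hF hd) w h hw

end HypersurfaceSpecimen

namespace MultiOrd

variable (k : Type) [Field k] {m : ℕ} (F : MvPolynomial (Fin (m + 2 + 1)) k) {d : ℕ} (hF : F.IsHomogeneous d) (hd : 0 < d)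

attribute [local instance] MvPolynomial.gradedAlgebra ProjBaseChange.algebraBase

/-! ## Bookkeeping -/

/-- **A prime form divides at most one variable**: for every `c` some `x_a ∉ (F)` with `a ≠ c` (two distinct variables are not associated).
[folklore] -/
theorem exists_X_ne_not_mem_span (hFp : Prime F) (c : Fin (m + 2 + 1)) :
    ∃ a : Fin (m + 2 + 1), a ≠ c ∧ (X a : MvPolynomial (Fin (m + 2 + 1)) k) ∉ Ideal.span {F} := by
  by_contra h
  push Not at h
  have h1 : F ∣ X (c.succAbove 0) := Ideal.mem_span_singleton.mp (h _ (Fin.succAbove_ne c 0))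
  have h2 : F ∣ X (c.succAbove 1) := Ideal.mem_span_singleton.mp (h _ (Fin.succAbove_ne c 1))
  have a1 := hFp.irreducible.associated_of_dvd (X_prime (i := (c.succAbove 0 : Fin (m + 2 + 1))) (R := k)).irreducible h1
  have a2 := hFp.irreducible.associated_of_dvd (X_prime (i := (c.succAbove 1 : Fin (m + 2 + 1))) (R := k)).irreducible h2
  have hdvd := (a1.symm.trans a2).dvd
  rw [X_dvd_X] at hdvd
  exact absurd (Fin.succAbove_right_injective hdvd) (by simp)

/-! ## `H` is regular off the marked vertices -/

/-- **The Jacobian hypothesis on the chart makes `ChartRing F c` regular at every prime missing some `x_a/x_c`**: through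
`ChartRing F c ≅ K[y]/(f)` (`f = F(x_c := 1)`, `(f)` radical; `x_{c.succAbove j}/x_c ↦ y_j`) such a prime is a prime of `K[y]/(f)` not containing all `y_j`,
hence (hypothesis) missing some `∂f/∂y_j`, and `K[y]/(f)` is regular there (Matsumura 14.2, the tree's pointwise Jacobian criterion).
[cite: Matsumura1987, Thm. 14.2] -/
theorem isRegularLocalRing_localization_chartRing (c : Fin (m + 2 + 1)) (f : MvPolynomial (Fin (m + 2)) k) (hdeh : dehomogenize k c F = f)
    (hrad : (Ideal.span {f}).radical = Ideal.span {f})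
    (hsing : ∀ P : Ideal (MvPolynomial (Fin (m + 2)) k), P.IsPrime → f ∈ P → (∀ j, pderiv j f ∈ P) →
      ∀ j, (X j : MvPolynomial (Fin (m + 2)) k) ∈ P)
    (𝔮 : Ideal (ChartRing F c hF)) [𝔮.IsPrime] {a : Fin (m + 2 + 1)} (hac : a ≠ c) (ha : tautVec F c hF a ∉ 𝔮) :
    IsRegularLocalRing (Localization.AtPrime 𝔮) := by
  obtain ⟨θ, hθ⟩ := HypersurfaceSpecimen.exists_chartQuotEquiv F hF c f hdeh hrad
  obtain ⟨j₀, hj₀⟩ : ∃ j : Fin (m + 2), c.succAbove j = a := Fin.exists_succAbove_eq hac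
  -- the corresponding prime of `K[y]/(f)` and of `K[y]`
  obtain ⟨𝔮', h𝔮'⟩ : ∃ P : Ideal (MvPolynomial (Fin (m + 2)) k ⧸ Ideal.span {f}), P = 𝔮.comap θ.symm.toRingHom := ⟨_, rfl⟩
  haveI : 𝔮'.IsPrime := by rw [h𝔮']; exact Ideal.comap_isPrime _ 𝔮
  have hmem : ∀ q, q ∈ 𝔮' ↔ θ.symm q ∈ 𝔮 := fun q => by rw [h𝔮', Ideal.mem_comap]; rfl
  obtain ⟨P, hP⟩ : ∃ P : Ideal (MvPolynomial (Fin (m + 2)) k), P = 𝔮'.comap (Ideal.Quotient.mk (Ideal.span {f})) := ⟨_, rfl⟩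
  haveI : P.IsPrime := by rw [hP]; exact Ideal.comap_isPrime _ 𝔮'
  have hfP : f ∈ P := by
    rw [hP, Ideal.mem_comap, Ideal.Quotient.eq_zero_iff_mem.mpr (Ideal.mem_span_singleton_self f)]
    exact zero_mem _
  have hyP : (X j₀ : MvPolynomial (Fin (m + 2)) k) ∉ P := by
    rw [hP, Ideal.mem_comap, hmem, ← hθ j₀, RingEquiv.symm_apply_apply, hj₀]
    exact ha
  -- some partial derivative survives
  have hex : ∃ j, pderiv j f ∉ P := by
    by_contra hall
    push Not at hall
    exact hyP (hsing P inferInstance hfP hall j₀)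
  obtain ⟨j, hj⟩ := hex
  have hj' : Ideal.Quotient.mk (Ideal.span {f}) (pderiv j f) ∉ 𝔮' := fun h => hj (by rw [hP, Ideal.mem_comap]; exact h)
  have hreg : IsRegularLocalRing (Localization.AtPrime 𝔮') :=
    Summit.ResolutionOfSingularities.ResolutionOfSingularities.Theorems.MvPolynomial.isRegularLocalRing_localization_quotient_of_pderiv_notMem
      𝔮' j hj'
  exact OrdPoint.isRegularLocalRing_localization_of_ringEquiv θ.symm 𝔮' 𝔮 (fun q => by rw [hmem]) hreg

include hd in
/-- **`H` is regular at every point that is none of the marked vertices.** If for each `c ∈ S` the chart equation `F(x_c := 1)` is radical and singular at most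
at the origin (Jacobian hypothesis), the charts `c ∉ S` are regular, and at `x ∈ H` for every `c ∈ S` some `x_a`, `a ≠ c`, does not vanish, then `𝒪_{H,x}`
is regular: `x` lies in a chart `D₊(x_c)`; if `c ∉ S` the chart ring is regular; if `c ∈ S`, `x ∈ D₊(x_a)` for some `a ≠ c`, i.e. `x_a/x_c ∉ 𝔮_x`
(`mem_basicOpen_chart_iff`), and `isRegularLocalRing_localization_chartRing` applies. [cite: Matsumura1987, Thm. 14.2] [cite: StacksProject, Tag 01I1] -/
theorem isRegularLocalRing_stalk_of_forall_exists (S : List (Fin (m + 2 + 1)))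
    (hsing : ∀ c ∈ S, (Ideal.span {dehomogenize k c F}).radical = Ideal.span {dehomogenize k c F} ∧
      ∀ P : Ideal (MvPolynomial (Fin (m + 2)) k), P.IsPrime → dehomogenize k c F ∈ P → (∀ j, pderiv j (dehomogenize k c F) ∈ P) →
        ∀ j, (X j : MvPolynomial (Fin (m + 2)) k) ∈ P)
    (hoffS : ∀ c, c ∉ S → IsRegularRing (ChartRing F c hF))
    (x : (hypersurface F).left)
    (hx : ∀ c ∈ S, ∃ a, a ≠ c ∧ (hypersurfaceι F).left x ∈ Proj.basicOpen (homogeneousSubmodule (Fin (m + 2 + 1)) k) (X a)) :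
    IsRegularLocalRing ((hypersurface F).left.presheaf.stalk x) := by
  obtain ⟨c, hc⟩ := HypersurfaceSpecimen.exists_mem_coordChartOpen ((hypersurfaceι F).left x)
  have hx' : x ∈ Set.range (chart F c hF hd).left := by
    rw [range_chart_left]
    exact hc
  obtain ⟨w, rfl⟩ := hx'
  by_cases hcS : c ∈ S
  · obtain ⟨a, hac, ha⟩ := hx c hcS
    replace ha := (HypersurfaceSpecimen.mem_basicOpen_chart_iff k F hF hd c a w).mp ha
    exact HypersurfaceSpecimen.isRegularLocalRing_stalk_chart k F hF hd c w
      (isRegularLocalRing_localization_chartRing k F hF c _ rfl (hsing c hcS).1 (hsing c hcS).2 w.asIdeal hac ha)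
  · haveI := hoffS c hcS
    exact HypersurfaceSpecimen.isRegularLocalRing_stalk_chart k F hF hd c w (IsRegularRing.isRegularLocalRing_localization w.asIdeal)

/-! ## EL♮ for hypersurfaces with ordinary multiple points at coordinate vertices -/

/-- **EL♮ HOLDS FOR EVERY HYPERSURFACE WHOSE SINGULAR POINTS ARE ORDINARY MULTIPLE POINTS AT COORDINATE VERTICES, IN EVERY DIMENSION AND CHARACTERISTIC.**
`K` algebraically closed of characteristic `p`; `F ∈ K[x₀,…,x_{m+2}]` a prime form; `S` a duplicate-free list of coordinates such that for `c ∈ S` the vertex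
chart is `F(x_c := 1) = Φ + Ψ` with `Φ` a NONSINGULAR form of degree `μ ≥ 1` (`P_c` is an ORDINARY `μ`-fold point of `H = V₊(F)`) and `Ψ ∈ (y)^{μ+1}`, the
affine hypersurface `F(x_c := 1)` being singular at most at the origin (Jacobian hypothesis), and such that the charts `ChartRing F c`, `c ∉ S`, are regular.
Then `Theorems.EquisingularLift.ELNatAt p K (m+2) H ι` (p503491): `O = 𝕎(K)`, ONE blow-up of `ℙ^{m+2}_O` along the product of the `O`-points through the
`P_c` (`elNatAt_of_coordPointsKill`); downstairs: blow-ups along a product of centres are regular where the blow-ups along the factors are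
(`MultiCentre.isRegular_of_prod`), each ordinary point is resolved pointwise by its blow-up (`OrdPointAt.isRegularLocalRing_stalk_of_isBlowup_comap`), and
`H` is regular off the marked vertices (`isRegularLocalRing_stalk_of_forall_exists`). Covers every hypersurface with nodes / ordinary multiple points at
some of the coordinate vertices and no other singularities — e.g. Cayley's 4-nodal cubic surface (next file). [OURS · L1 W4.5b] [folklore] -/
theorem elNatAt_ordinaryPoints (p : ℕ) (hp : p.Prime) (K : Type) [Field K] [CharP K p] [IsAlgClosed K] {m : ℕ}
    (F : MvPolynomial (Fin (m + 2 + 1)) K) {d : ℕ} (hF : F.IsHomogeneous d) (hFp : Prime F)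
    (S : List (Fin (m + 2 + 1))) (hS : S.Nodup)
    (hord : ∀ c ∈ S, ∃ (μ : ℕ) (Φ Ψ : MvPolynomial (Fin (m + 2)) K), 1 ≤ μ ∧ Φ.IsHomogeneous μ ∧ IsNonsingularForm K Φ ∧
      Ψ ∈ Ideal.span (Set.range (X : Fin (m + 2) → MvPolynomial (Fin (m + 2)) K)) ^ (μ + 1) ∧ dehomogenize K c F = Φ + Ψ)
    (hsing : ∀ c ∈ S, ∀ P : Ideal (MvPolynomial (Fin (m + 2)) K), P.IsPrime → dehomogenize K c F ∈ P →
      (∀ j, pderiv j (dehomogenize K c F) ∈ P) → ∀ j, (X j : MvPolynomial (Fin (m + 2)) K) ∈ P)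
    (hoffS : ∀ c, c ∉ S → IsRegularRing (ChartRing F c hF)) :
    Theorems.EquisingularLift.ELNatAt p K (m + 2) (hypersurface F).left (hypersurfaceι F).left := by
  classical
  have hd : 0 < d := ConeN.pos_of_prime_of_isHomogeneous K F hF hFp
  have he : ∀ c : Fin (m + 2 + 1), Function.Injective (fun _ : Fin 1 => c) := fun c => Function.injective_of_subsingleton _
  have hexk : ∀ c : Fin (m + 2 + 1), ∃ (g : homogeneousSubmodule (Fin (m + 2 + 1)) K →+*ᵍ homogeneousSubmodule (Fin (0 + 1)) K)
      (_ : HomogeneousIdeal.irrelevant (homogeneousSubmodule (Fin (0 + 1)) K) ≤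
        (HomogeneousIdeal.irrelevant (homogeneousSubmodule (Fin (m + 2 + 1)) K)).map g),
      (∀ a : K, g (C a) = C a) ∧ (∀ j : Fin 1, g (X ((fun _ : Fin 1 => c) j)) = X j) ∧
        (∀ i : Fin (m + 2 + 1), i ∉ Set.range (fun _ : Fin 1 => c) → g (X i) = 0) := fun c =>
    LinearCentre.exists_kill (R := K) (fun _ : Fin 1 => c) (he c)
  choose fk hfk' hfkC hfke hfk0 using hexk
  have hfke' : ∀ c (j : Fin 1), fk c (X c) = X j := fun c j => hfke c j
  have hfk0' : ∀ c (i : Fin (m + 2 + 1)), i ≠ c → fk c (X i) = 0 := fun c i hi => hfk0 c i (fun ⟨_, hj⟩ => hi hj.symm)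
  have hec : ∀ c : Fin (m + 2 + 1), ∀ j : Fin 1, (fun _ : Fin 1 => c) j = c := fun _ _ => rfl
  haveI := HypersurfaceSpecimen.isIntegral_hypersurface_of_prime K F hF hFp
  -- radicality of the chart equations at the marked vertices
  have hrad : ∀ c ∈ S, (Ideal.span {dehomogenize K c F}).radical = Ideal.span {dehomogenize K c F} := by
    intro c hc
    obtain ⟨μ, Φ, Ψ, hμ, hΦ, -, hΨ, hdeh⟩ := hord c hc
    rw [hdeh]
    exact OrdPointAt.radical_span_dehomogenize_eq K F c hF hFp Φ Ψ hΦ hμ hΨ hdeh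
  refine elNatAt_of_coordPointsKill p hp K S hS _ (hypersurfaceι F).left fk hfk' hfkC hfke' hfk0' ?_ ?_ ?_
  · -- `supp Π Λ_c ⊆ ι(H)`: the marked vertices lie on `H`
    intro y hy
    obtain ⟨c, hc, hyc⟩ := (CoordPoints.mem_support_prod_iff fk hfk' S y).mp hy
    obtain ⟨μ, Φ, Ψ, hμ, hΦ, -, hΨ, hdeh⟩ := hord c hc
    have hX : ∀ j : Fin (m + 2), (X (c.succAbove j) : MvPolynomial (Fin (m + 2 + 1)) K) ∈ y.asHomogeneousIdeal := fun j =>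
      CoordPoints.X_mem_of_mem_support fk hfk' hfkC hfke' hfk0' hyc (Fin.succAbove_ne c j)
    refine (Set.ext_iff.mp (range_hypersurfaceι F) y).mpr ((ProjectiveSpectrum.mem_zeroLocus _ _ _).mpr (Set.singleton_subset_iff.mpr ?_))
    change F ∈ y.asHomogeneousIdeal
    exact (Ideal.span_le.mpr (Set.range_subset_iff.mpr hX)) (OrdPointAt.mem_span_X_succAbove K F c hF Φ Ψ hΦ hμ hΨ hdeh)
  · -- `ι(H) ⊄ supp Π Λ_c`: the generic point of `H` is no vertex
    intro h
    have hmem : (pointOfPrime F hF hFp : Proj (homogeneousSubmodule (Fin (m + 2 + 1)) K)) ∈ Set.range (hypersurfaceι F).left := by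
      refine (Set.ext_iff.mp (range_hypersurfaceι F) _).mpr ((ProjectiveSpectrum.mem_zeroLocus _ _ _).mpr (Set.singleton_subset_iff.mpr ?_))
      exact Ideal.subset_span rfl
    obtain ⟨c, -, hyc⟩ := (CoordPoints.mem_support_prod_iff fk hfk' S _).mp (h hmem)
    obtain ⟨a, hac, ha⟩ := exists_X_ne_not_mem_span K F hFp c
    exact ha (CoordPoints.X_mem_of_mem_support fk hfk' hfkC hfke' hfk0' hyc hac)
  · -- every blow-up of `H` along `Π Λ_c·𝒪_H` is regular
    intro Z ρ hρ
    rw [MultiCentre.comap_list_prod, List.map_map] at hρ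
    refine MultiCentre.isRegular_of_prod _ ?_ ?_ ?_ hρ
    · -- pairwise disjoint supports
      rw [List.pairwise_map]
      refine hS.pairwise_of_forall_ne fun c _ c' _ hcc' => ?_
      simp only [Function.comp_apply]
      rw [Set.disjoint_iff]
      rintro x ⟨hx, hx'⟩
      have h1 : (hypersurfaceι F).left x ∈ ((Proj.map (fk c) (hfk' c)).ker.support : Set (Proj (homogeneousSubmodule (Fin (m + 2 + 1)) K))) := by
        have h := hx; rwa [Scheme.IdealSheafData.support_comap] at h
      have h2 : (hypersurfaceι F).left x ∈ ((Proj.map (fk c') (hfk' c')).ker.support : Set (Proj (homogeneousSubmodule (Fin (m + 2 + 1)) K))) := by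
        have h := hx'; rwa [Scheme.IdealSheafData.support_comap] at h
      exact (CoordPoints.disjoint_support_ker fk hfk' hfkC hfke' hfk0' hcc').le_bot ⟨h1, h2⟩
    · -- each factor: an ordinary point, resolved pointwise; off it the blow-up is a local isomorphism
      intro I hI X₁ τ₁ hτ₁ z hz
      obtain ⟨c, hc, rfl⟩ := List.mem_map.mp hI
      simp only [Function.comp_apply] at hτ₁ hz ⊢
      by_cases hzs : τ₁ z ∈ ((((Proj.map (fk c) (hfk' c)).ker).comap (hypersurfaceι F).left).support : Set (hypersurface F).left)
      · obtain ⟨μ, Φ, Ψ, hμ, hΦ, hns, hΨ, hdeh⟩ := hord c hc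
        exact OrdPointAt.isRegularLocalRing_stalk_of_isBlowup_comap K F c hF hFp (hec c) (fk c) (hfk' c) (hfkC c) (hfke c) (hfk0 c)
          Φ Ψ hΦ hμ hns hΨ hdeh hτ₁ z hzs
      · rcases hz with hz | hz
        · exact absurd hz hzs
        · haveI := hτ₁.isIso_stalkMap_of_not_mem_support hzs
          haveI : IsRegularLocalRing ((hypersurface F).left.presheaf.stalk (τ₁ z)) := hz
          exact IsRegularLocalRing.of_ringEquiv (R := (hypersurface F).left.presheaf.stalk (τ₁ z)) (asIso (τ₁.stalkMap z)).commRingCatIsoToRingEquiv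
    · -- `H` is regular off the marked vertices
      intro x hx
      refine isRegularLocalRing_stalk_of_forall_exists K F hF hd S (fun c hc => ⟨hrad c hc, hsing c hc⟩) hoffS x (fun c hc => ?_)
      have hxc : (hypersurfaceι F).left x ∉ ((Proj.map (fk c) (hfk' c)).ker.support : Set (Proj (homogeneousSubmodule (Fin (m + 2 + 1)) K))) := by
        intro h
        apply hx
        rw [IdealSheafData.coe_support_prod, Set.mem_iUnion₂]
        refine ⟨_, List.mem_map.mpr ⟨c, hc, rfl⟩, ?_⟩
        simp only [Function.comp_apply]
        rw [Scheme.IdealSheafData.support_comap]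
        exact h
      obtain ⟨a, ha, hXa⟩ := LinearCentre.exists_X_not_mem_of_not_mem_support (fun _ : Fin 1 => c) (he c) (fk c) (hfk' c) (hfkC c) (hfke c)
        (hfk0 c) hxc
      exact ⟨a, (OrdPointAt.not_mem_range_iff c (hec c) a).mp ha, (Proj.mem_basicOpen _ _ _).mpr hXa⟩

end MultiOrd

end Summit.ResolutionOfSingularities.ResolutionOfSingularities.Cruxes.EquisingularLiftNat.Sections

end
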